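import Summits.CriticalPhenomena.PercolationContinuityZ3.Theorems.SahiMasterFamilyDenseEndReflection
import Summits.CriticalPhenomena.PercolationContinuityZ3.Theorems.SahiMasterFamilySparseEndLimit

/-!
# The dense end of Sahi's hierarchy, II: `E_k(μ_{1−q·w}; 1_U) = q^{m₂} · Ê(q)` with `Ê` continuous — the ORDER OF VANISHING at `p → 1`

Support file of the master-family programme (crux `NoHeavyLowerTail`, stmt-CriticalPhenomena-4575; cell `prim-masterthm`, seat P4,
unit `prim-masterthm-p4-g5`).  Seat document HOME/prim-masterthm-p4/CORNERS.md §1 (Theorem D, step (b)).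

By `SahiMasterFamilyDenseEndReflection.sahiE_dpw_eq_sum`, the dense end of a family of `k ≥ 2` increasing events `U_i` is a signed
combination of the sparse-end functionals of the sub-families of the reflected failure events `A_i = reflA U_i`; each of these
factors as `q^{m_S} Ẽ_S(q)` (gen 4, `sahiE_spw_eq`, extended here to every arity as `sahiE_spw_eq'`), and for `|S| ≥ 2` the order
`m_S` is at least `m₂ :=` the minimum size of a configuration lying in (at least) two of the `A_i` — the CHEAPEST DOUBLE FAILURE of
the original family (`m2_le_minSize'`); the `|S| = 1` terms carry the coefficient `brCoeff 1 (k−1) = 0`.  Hence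

* **`sahiE_dpw_eq_pow_mul`** — `E_k(dpw w q; 1_U) = q^{m₂} · Ê(q)` for all real `q`, with `Ê = denseE` an explicit finite sum,
* `continuous_denseE` — `Ê` is continuous, so `E_k(μ_{1 − q w}; 1_U) = O(q^{m₂})` and `E_k / q^{m₂} → Ê(0)` (`tendsto_sahiE_dpw_div_pow`):
  **at the dense end Sahi's functional of increasing events vanishes at least to the order of the cheapest double failure**, every `k ≥ 2`.
The SIGN of `Ê(0)` (`= (k−2)! Σ_c w^c (1 − Z(c)) ≥ 0`, Theorem D of CORNERS.md §1, paper proof (c)–(d)) is not formalised in this file.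
HONEST FRAMING: first-order information at `p → 1` only; Sahi `C_k` / Kahn Conj. 5 / the master theorem remain open.  [this work]
-/

namespace Summit.CriticalPhenomena.PercolationContinuityZ3.Theorems

namespace SahiSparseEnd

open Finset Filter Topology Function SahiComplement
open Literature.Combinatorics.Sahi2008

variable {ι : Type*} [Fintype ι] [DecidableEq ι]

/-! ### Sparse-end quantities at every arity -/

/-- `Ẽ` at every arity (`0` at arity `0`). [this work] -/
noncomputable def sparseE' (w : ι → ℝ) : {s : ℕ} → (Fin s → Finset (Finset ι)) → ℕ → ℝ → ℝ
  | 0, _, _, _ => 0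
  | _ + 1, B, m, q => sparseE w B m q

/-- The minimum size of a common configuration, at every arity (`0` at arity `0`). [this work] -/
noncomputable def minSize' : {s : ℕ} → (B : Fin s → Finset (Finset ι)) → (∀ i, (univ : Finset ι) ∈ B i) → ℕ
  | 0, _, _ => 0
  | _ + 1, B, h => minSize B (common_nonempty B h)

/-- `Ẽ` is continuous at every arity. [this work] -/
@[fun_prop]
theorem continuous_sparseE' (w : ι → ℝ) : ∀ {s : ℕ} (B : Fin s → Finset (Finset ι)) (m : ℕ),
    Continuous fun q : ℝ => sparseE' w B m q
  | 0, _, _ => continuous_const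
  | _ + 1, B, m => continuous_sparseE w B m

/-- **The sparse-end factorisation at every arity**: `E_s(spw w q; 1_B) = q^{m} · Ẽ(q)`. [this work] -/
theorem sahiE_spw_eq' (w : ι → ℝ) (q : ℝ) : ∀ {s : ℕ} (B : Fin s → Finset (Finset ι))
    (hB : ∀ i a a', a ∈ B i → a ⊆ a' → a' ∈ B i) (h : ∀ i, (univ : Finset ι) ∈ B i),
    sahiE (spw w q) s (fun i => setInd (B i)) = q ^ minSize' B h * sparseE' w B (minSize' B h) q
  | 0, _, _, _ => by rw [sahiE_zero, sparseE', mul_zero]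
  | _ + 1, B, hB, h => sahiE_spw_eq B hB w q (common_nonempty B h)

/-- A lower bound for `minSize'`: if every common configuration has size `≥ m` then `m ≤ minSize'` (arity `≥ 1`). [this work] -/
theorem le_minSize' {s : ℕ} (B : Fin (s + 1) → Finset (Finset ι)) (h : ∀ i, (univ : Finset ι) ∈ B i) {m : ℕ}
    (hm : ∀ a : Finset ι, (∀ i, a ∈ B i) → m ≤ a.card) : m ≤ minSize' B h := by
  show m ≤ minSize B (common_nonempty B h)
  refine le_min' _ _ _ fun x hx => ?_
  obtain ⟨a, ha, rfl⟩ := mem_image.1 hx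
  exact hm a ((mem_common B).1 ha)

/-! ### The cheapest double failure `m₂` -/

section Events

variable {k : ℕ} (A : Fin k → Finset (Finset ι))

/-- Configurations lying in at least two of the events. [this work] -/
def doubly (A : Fin k → Finset (Finset ι)) : Finset (Finset ι) :=
  univ.filter fun c => 2 ≤ (univ.filter fun i => c ∈ A i).card

/-- `m₂`: the minimum size of a configuration lying in at least two of the events (the cheapest double failure). [this work] -/
noncomputable def m2 (A : Fin k → Finset (Finset ι)) (h : (doubly A).Nonempty) : ℕ := ((doubly A).image Finset.card).min' (h.image _)

variable {A}

/-- With `k ≥ 2` events all containing `univ`, `doubly A` is nonempty. [this work] -/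
theorem doubly_nonempty (hk : 2 ≤ k) (h : ∀ i, (univ : Finset ι) ∈ A i) : (doubly A).Nonempty := by
  refine ⟨univ, mem_filter.2 ⟨mem_univ _, ?_⟩⟩
  rw [filter_true_of_mem fun i _ => h i, card_univ, Fintype.card_fin]
  exact hk

/-- Every doubly covered configuration has size `≥ m₂`. [this work] -/
theorem m2_le_card {h : (doubly A).Nonempty} {c : Finset ι} (hc : c ∈ doubly A) : m2 A h ≤ c.card :=
  min'_le _ _ (mem_image_of_mem _ hc)

/-- The sub-family indexed by `S` (increasing enumeration). [this work] -/
def subFam (A : Fin k → Finset (Finset ι)) (S : Finset (Fin k)) : Fin S.card → Finset (Finset ι) :=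
  fun j => A (S.orderEmbOfFin rfl j)

/-- Lower bound for `minSize'` at any positive arity. [this work] -/
theorem le_minSize'_of {s : ℕ} (hs : 1 ≤ s) (B : Fin s → Finset (Finset ι)) (h : ∀ i, (univ : Finset ι) ∈ B i) {m : ℕ}
    (hm : ∀ a : Finset ι, (∀ i, a ∈ B i) → m ≤ a.card) : m ≤ minSize' B h := by
  obtain ⟨n, rfl⟩ : ∃ n, s = n + 1 := ⟨s - 1, by omega⟩
  exact le_minSize' B h hm

/-- **`m₂ ≤ m_S` for `|S| ≥ 2`**: every configuration common to the sub-family `A_S` is doubly covered. [this work] -/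
theorem m2_le_minSize'_subFam (h : (doubly A).Nonempty) (hu : ∀ i, (univ : Finset ι) ∈ A i) {S : Finset (Fin k)}
    (h2 : 2 ≤ S.card) : m2 A h ≤ minSize' (subFam A S) (fun _ => hu _) := by
  refine le_minSize'_of (by omega) _ _ fun a ha => m2_le_card (mem_filter.2 ⟨mem_univ _, ?_⟩)
  refine h2.trans (card_le_card fun i hi => mem_filter.2 ⟨mem_univ _, ?_⟩)
  have hi' : i ∈ Set.range (S.orderEmbOfFin rfl) := by rw [range_orderEmbOfFin]; exact hi
  obtain ⟨j, rfl⟩ := hi'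
  exact ha j

/-- `brCoeff 1 t = 0` for `t ≥ 1` (the singleton terms of the complement expansion vanish). [this work] -/
theorem brCoeff_one {t : ℕ} (ht : 1 ≤ t) : brCoeff 1 t = 0 := by
  rw [brCoeff]
  exact prod_eq_zero (mem_range.2 (by omega : 0 < t)) (by norm_num)

end Events

/-! ### The factorisation at the dense end -/

section Dense

variable {k : ℕ} (U : Fin k → Finset (Finset ι)) (hk : 2 ≤ k)
  (hU : ∀ i a a', a ∈ U i → a ⊆ a' → a' ∈ U i) (h0 : ∀ i, ∅ ∉ U i)

/-- The reflected failure events `A_i = reflA U_i`. [this work] -/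
def reflFam (U : Fin k → Finset (Finset ι)) : Fin k → Finset (Finset ι) := fun i => reflA (U i)

/-- `univ ∈ A_i` (from `∅ ∉ U_i`). [this work] -/
theorem univ_mem_reflFam (h0 : ∀ i, ∅ ∉ U i) (i : Fin k) : (univ : Finset ι) ∈ reflFam U i := univ_mem_reflA (h0 i)

/-- `m₂` of the family: the cheapest double failure. [this work] -/
noncomputable def mTwo (U : Fin k → Finset (Finset ι)) (hk : 2 ≤ k) (h0 : ∀ i, ∅ ∉ U i) : ℕ :=
  m2 (reflFam U) (doubly_nonempty hk (univ_mem_reflFam U h0))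

/-- `m_S` of the sub-family `A_S`. [this work] -/
noncomputable def mSub (U : Fin k → Finset (Finset ι)) (h0 : ∀ i, ∅ ∉ U i) (S : Finset (Fin k)) : ℕ :=
  minSize' (subFam (reflFam U) S) fun _ => univ_mem_reflFam U h0 _

/-- **`Ê(q)`**: the reduced dense-end functional,
`Σ_{|S| ≥ 1} (−1)^{|S|} brCoeff(|S|, k−|S|) · q^{m_S − m₂} · Ẽ_S(q)`. [this work] -/
noncomputable def denseE (w : ι → ℝ) (U : Fin k → Finset (Finset ι)) (hk : 2 ≤ k) (h0 : ∀ i, ∅ ∉ U i) (q : ℝ) : ℝ :=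
  ∑ S ∈ ((univ : Finset (Fin k)).powerset).filter (fun S => 1 ≤ S.card),
    (-1 : ℝ) ^ S.card * (brCoeff S.card (k - S.card) *
      (q ^ (mSub U h0 S - mTwo U hk h0) * sparseE' w (subFam (reflFam U) S) (mSub U h0 S) q))

/-- `Ê` is continuous. [this work] -/
theorem continuous_denseE (w : ι → ℝ) : Continuous fun q : ℝ => denseE w U hk h0 q := by
  unfold denseE; fun_prop

include hU in
/-- **THE DENSE-END FACTORISATION (all orders `k ≥ 2`)**: `E_k(dpw w q; 1_U) = q^{m₂} · Ê(q)` for every real `q`, where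
`dpw w q` is the product weight with intensities `1 − q w_e` and `m₂` the cheapest double failure. [this work] -/
theorem sahiE_dpw_eq_pow_mul (w : ι → ℝ) (q : ℝ) :
    sahiE (dpw w q) k (fun i => setInd (U i)) = q ^ mTwo U hk h0 * denseE w U hk h0 q := by
  rw [sahiE_dpw_eq_sum U hk, denseE, mul_sum]
  refine sum_congr rfl fun S hS => ?_
  have hS1 : 1 ≤ S.card := (mem_filter.1 hS).2
  have hAup : ∀ (j : Fin S.card) a a', a ∈ subFam (reflFam U) S j → a ⊆ a' → a' ∈ subFam (reflFam U) S j :=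
    fun _ a a' => reflA_up (hU _) a a'
  have e := sahiE_spw_eq' w q (subFam (reflFam U) S) hAup (fun j => univ_mem_reflFam U h0 _)
  have e' : sahiE (spw w q) S.card (fun j => setInd (reflA (U (S.orderEmbOfFin rfl j)))) =
      q ^ mSub U h0 S * sparseE' w (subFam (reflFam U) S) (mSub U h0 S) q := e
  rw [e']
  rcases Nat.lt_or_ge S.card 2 with h1 | h2
  · have hb : brCoeff S.card (k - S.card) = 0 := by
      have hc : S.card = 1 := by omega
      rw [hc]; exact brCoeff_one (by omega)
    rw [hb]
    ring
  · have hle : mTwo U hk h0 ≤ mSub U h0 S := m2_le_minSize'_subFam _ (univ_mem_reflFam U h0) h2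
    rw [← Nat.add_sub_cancel' hle, pow_add, Nat.add_sub_cancel_left]
    ring

include hU in
/-- **Order of vanishing at the dense end**: `E_k(dpw w q; 1_U) / q^{m₂} → Ê(0)` as `q → 0`, `q ≠ 0`; in particular
`E_k(μ_{1−q w}; 1_U) = O(q^{m₂})`. [this work] -/
theorem tendsto_sahiE_dpw_div_pow (w : ι → ℝ) :
    Tendsto (fun q : ℝ => sahiE (dpw w q) k (fun i => setInd (U i)) / q ^ mTwo U hk h0)
      (𝓝[≠] 0) (𝓝 (denseE w U hk h0 0)) := by
  have hc : Tendsto (fun q : ℝ => denseE w U hk h0 q) (𝓝[≠] 0) (𝓝 (denseE w U hk h0 0)) :=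
    ((continuous_denseE U hk h0 w).tendsto 0).mono_left nhdsWithin_le_nhds
  refine hc.congr' ?_
  filter_upwards [self_mem_nhdsWithin] with q hq
  rw [sahiE_dpw_eq_pow_mul U hk hU h0 w q, mul_div_cancel_left₀ _ (pow_ne_zero _ hq)]

/-- **`Ê(0)`**: only the sub-families with `|S| ≥ 2` and `m_S = m₂` contribute:
`Ê(0) = Σ_{|S| ≥ 2, m_S = m₂} (−1)^{|S|} brCoeff(|S|, k−|S|) · Ẽ_S(0)`. [this work] -/
theorem denseE_zero_eq (w : ι → ℝ) :
    denseE w U hk h0 0 = ∑ S ∈ ((univ : Finset (Fin k)).powerset).filter (fun S => 2 ≤ S.card ∧ mSub U h0 S = mTwo U hk h0),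
      (-1 : ℝ) ^ S.card * (brCoeff S.card (k - S.card) * sparseE' w (subFam (reflFam U) S) (mSub U h0 S) 0) := by
  rw [denseE]
  have hsub : ((univ : Finset (Fin k)).powerset).filter (fun S => 2 ≤ S.card ∧ mSub U h0 S = mTwo U hk h0) ⊆
      ((univ : Finset (Fin k)).powerset).filter (fun S => 1 ≤ S.card) := by
    intro S hS
    rw [mem_filter] at hS ⊢
    exact ⟨hS.1, by omega⟩
  rw [← sum_subset hsub]
  · refine sum_congr rfl fun S hS => ?_
    rw [(mem_filter.1 hS).2.2, Nat.sub_self, pow_zero, one_mul]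
  · intro S hS hS'
    rw [mem_filter] at hS hS'
    rcases Nat.lt_or_ge S.card 2 with h1 | h2
    · have hb : brCoeff S.card (k - S.card) = 0 := by
        have hc : S.card = 1 := by omega
        rw [hc]; exact brCoeff_one (by omega)
      rw [hb]
      ring
    · have hne : mSub U h0 S ≠ mTwo U hk h0 := fun h => hS' ⟨hS.1, h2, h⟩
      have hlt : mTwo U hk h0 < mSub U h0 S :=
        lt_of_le_of_ne (m2_le_minSize'_subFam _ (univ_mem_reflFam U h0) h2) (Ne.symm hne)
      rw [zero_pow (by omega), zero_mul, mul_zero, mul_zero]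

end Dense


end SahiSparseEnd

end Summit.CriticalPhenomena.PercolationContinuityZ3.Theorems
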